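/-
Copyright: the b2b-balaban T⁴-continuum CRUX team, row NE7b OWNER lineage `t4-ne7b-p1` (gen 146). Project licence.
-/
import Summits.QuantumFields.BalabanUV.T4Continuum.Spine.NE7b.SupWeightedTwoPointMastersTwo
import Summits.QuantumFields.BalabanUV.T4Continuum.Spine.NE7b.SupWeightedFivePointToolsThree
import Summits.QuantumFields.BalabanUV.T4Continuum.Spine.NE7b.SupFivePointGreedyRowSum

/-!
# THE WEIGHTED FIFTH-ORDER SLOT LETTER, SLOT FIVE (`s` fixed), PART 1 OF 8 (SCOPING-d17 §F, F13–F17; file (729)).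
# The interpolated entry majorant `M₅′` of (687) (52 terms, no support indicator, product decay) summed over its four free indices against
# the full-graph weight `W = Π_{10 pairs}ϑ` with `s` fixed — the OUTPUT slot letter of the weighted class at order five — from weighted INPUT
# letters only: the full-graph `ϑ₂`-weighted `K5` letter of this role, the `σ`-profile letters of the `Hk`∕`K3`∕`K4`∕`K5` families (masses and
# columns; discharged from intrinsic letters as in (659)∕(666)), the `ϑ₂`-weighted `Hk`∕`K3` letters, and three geometry letters (`G = sup
# Σϑ⁶∕√ρ`, `Θ8 = sup Σϑ⁸∕ϑ₂`, `S2 = sup Σϑ²∕r₁`).  ROUTING: every pair of the five indices is carried along the term's tree (loads `≤ 6` on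
# `ρ`-edges and the crossing edge — `ϑ⁶ ≤ σσ` —, `≤ 4` on Hessian∕internal edges — `ϑ⁴ ≤ ϑ₂` —, `≤ 2` on `r₁`-star edges; non-star pairs of the
# product-decay terms absorbed by `ϑ ≤ r₁`), then summed leaf-first ((689)∕(691)).  NO support letter, NO finite-range hypothesis
# (row NE7b, node U5c; (653), (656), (687), (689), (691) BY NAME; [folklore]).

Cell `pub-balaban`, sub-cell `t4`, spine estimate NE7b (`T4WeightBudget.RelWeightBound`; the cell's OWN estimate — NOT PRINTED in
[Bałaban 1983–89], NOT PROVED).  Crux-route work under `Spine/NE7b/` by the row OWNER (`t4-ne7b-p1` gen 146, file (729)) under FREEZE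
(0)'s crux-prover clause; NOTHING of Bałaban's is named as a Lean object, valued or asserted; no `T4Continuum/Support` leaf typed; no
`def`, no notation (`M₅′`'s terms WRITTEN OUT as printed by (687)); zero `sorry`.  Imports (BY NAME): (656), (700) ((691), (689), (653),
(649) through them), (538) (`sum4_rot3∕4`).

WHAT IS PROVED ([folklore]): **`output_k5ϑ_s_part1`**; toy.

HONEST (what this is NOT).  One slot (part) of five; hypotheses = the weighted-class letters of SCOPING-d17 §D∕§F at order five (rates `ϑ⁴ ≤ ϑ₂`,
`ϑ⁶ ≤ σσ`, `ϑ ≤ r₁`, `Σϑ⁸∕ϑ₂, Σϑ⁶∕√ρ, Σϑ²∕r₁ < ∞`); the `K5` profile discharges and the packaging are later files; scalar skeleton ((A3),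
NC-NE7b-α UNRULED); nothing of Bałaban's asserted.  BY-NAME EFFECT ON THE WALL: NONE.  NE7b NOT PRINTED ∕ NOT PROVED; spine PROVED 0∕9; rung
(B)+1 — the programme's measures remain FINITE-torus statements; NOT the mass gap, NOT Clay.  HONEST DEPENDENCY: continuum YM on T⁴ ⇐ BetaPertH
∧ nine spine estimates (0∕9 proved); BetaPertH ⇐ (D1) ∧ (D4) ∧ CAP+tail; G-an2-4 gates asym, D1 and NE2∕3∕4.
-/

set_option autoImplicit false

noncomputable section

namespace Summit.QuantumFields.BalabanUV.T4Continuum.NE7b.SupWeightedFifthOrderLettersFivePart1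

open Finset Real
open scoped BigOperators
open SupWeightedSlotTools (sum_sqrt_mul_le_letters)
open SupWeightedTwoPointMasters (weighted_two_point_family_le weighted_two_point_family_le')
open SupWeightedTwoPointMastersTwo (weighted_two_point_two_families_le weighted_two_point_two_families_le')
open SupWeightedFivePointTools
open SupWeightedFivePointToolsTwo (rmono smono tmono pmono geom2 sum2_sqrt_mul_le_letters' absorb_le_one mul_le_one_of sqrt_split3
  sqrt_split4 sqrt_split_tree)
open SupWeightedFivePointToolsThree (pmono_first pmono_second geom_first geom_second)
open SupFivePointGreedyRowSum (sum4_rot3 sum4_rot4)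

variable {ι κ : Type} [Fintype ι] [Fintype κ]

variable {Hk : ι → ι → ℝ} {K3 : ι → ι → ι → ℝ} {K4 : ι → ι → ι → ι → ℝ} {K5 : ι → ι → ι → ι → ι → ℝ} {A : Matrix ι κ ℝ} {D : κ → κ → ℝ}
  {ϑ ϑ₂ ρ r₁ : ι → ι → ℝ} {σ : ι → κ → ℝ} {θ : κ → κ → ℝ}
  {κ₂ γop lam lamA C3k C3h C4 C5 dθ dθ' αθ αθc αg1m αg2m αg1c αk4m1 αk4m2 αk4m3 αk4c αk5m1 αk5m2 αk5m3 αk5m4 αk5c hrϑ hcϑ k3rϑ k3mϑ k3cϑ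
    k5ϑ1 k5ϑ2 k5ϑ3 k5ϑ4 k5ϑ5 G Θ8 S2 : ℝ}

set_option maxHeartbeats 1600000 in
/-- **WEIGHTED FIFTH-ORDER SLOT LETTER, `s` FIXED, PART 1 OF 8**: terms `0, 1, 2, 3, 4, 5, 6, 7, 8` of `M₅′` ((687)) summed over
the four free indices against the full-graph weight `Π_{10 pairs}ϑ`. [folklore] -/
theorem output_k5ϑ_s_part1 (hK50 : ∀ a b c d u, 0 ≤ K5 a b c d u) (hK40 : ∀ a b c u, 0 ≤ K4 a b c u) (hK30 : ∀ a b u, 0 ≤ K3 a b u)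
    (hHk0 : ∀ v u, 0 ≤ Hk v u)
    (hD : ∀ x y, 0 ≤ D x y) (hlamA1 : lamA < 1) (hθnn : ∀ z w, 0 ≤ θ z w) (hDθr : ∀ z', ∑ w, D z' w * θ z' w ≤ dθ) (hdθ : 0 ≤ dθ)
    (hDθc : ∀ w, ∑ z', D z' w * θ z' w ≤ dθ') (hdθ' : 0 ≤ dθ') (hσ0 : ∀ x w, 0 ≤ σ x w) (hσθ : ∀ x z' w, σ x w ≤ σ x z' * θ z' w)
    (hϑ1 : ∀ x y, 1 ≤ ϑ x y) (hϑsymm : ∀ x y, ϑ x y = ϑ y x) (hϑmul : ∀ x y z, ϑ x z ≤ ϑ x y * ϑ y z) (hϑ4 : ∀ x y, ϑ x y ^ 4 ≤ ϑ₂ x y)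
    (hϑ₂symm : ∀ x y, ϑ₂ x y = ϑ₂ y x) (hϑσ6 : ∀ x y w, ϑ x y ^ 6 ≤ σ x w * σ y w) (hρ0 : ∀ x y, 0 < ρ x y) (hρsymm : ∀ x y, ρ x y = ρ y x)
    (hG : ∀ a, ∑ b, ϑ a b ^ 6 / Real.sqrt (ρ a b) ≤ G) (hΘ : ∀ a, ∑ b, (ϑ a b ^ 4) ^ 2 / ϑ₂ a b ≤ Θ8)
    (hk3m : ∀ y, ∑ x, ∑ v, K3 x y v * (ϑ₂ y x * ϑ₂ y v * ϑ₂ x v) ≤ k3mϑ) (hbσ : ∀ v, ∑ z', (∑ u, |A u z'| * Hk v u) * σ v z' ≤ αθ)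
    (hbσc : ∀ z', ∑ v, (∑ u, |A u z'| * Hk v u) * σ v z' ≤ αθc) (hαθc : 0 ≤ αθc)
    (hg1c : ∀ z', ∑ x, ∑ y, (∑ u, |A u z'| * K3 x y u) * (σ x z' * ϑ₂ x y) ≤ αg1c) (hαg1c : 0 ≤ αg1c)
    (hk4m3 : ∀ s, ∑ p, ∑ q, (ϑ₂ s p * ϑ₂ s q * ϑ₂ p q) * ∑ z', (∑ u, |A u z'| * K4 p q s u) * σ s z' ≤ αk4m3)
    (hk5m4 : ∀ s, ∑ a, ∑ b, ∑ c, (ϑ₂ s a * ϑ₂ s b * ϑ₂ s c * ϑ₂ a b * ϑ₂ a c * ϑ₂ b c) * ∑ z', (∑ u, |A u z'| * K5 a b c s u) * σ s z' ≤ αk5m4)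
    (hk5c : ∀ z', ∑ a, ∑ b, ∑ c, ∑ d, (∑ u, |A u z'| * K5 a b c d u) * (σ a z' * (ϑ₂ a b * ϑ₂ a c * ϑ₂ a d * ϑ₂ b c * ϑ₂ b d * ϑ₂ c d)) ≤ αk5c)
    (hαk5c : 0 ≤ αk5c)
    (hk5 : ∀ s, ∑ x, ∑ y, ∑ z, ∑ t, K5 y z t s x * (ϑ₂ x y * ϑ₂ x z * ϑ₂ x t * ϑ₂ x s * ϑ₂ y z * ϑ₂ y t * ϑ₂ y s * ϑ₂ z t * ϑ₂ z s * ϑ₂ t s) ≤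
          k5ϑ4) (s : ι) :
    ∑ x, ∑ y, ∑ z, ∑ t,
        ((K5 y z t s x : ℝ) + (∑ w, (∑ z', D z' w * ∑ u, |A u z'| * Hk x u) * (∑ z', D z' w * ∑ u, |A u z'| * K5 y z t s u) / (1 - lamA) : ℝ) +
          (∑ w, (∑ z', D z' w * ∑ u, |A u z'| * K5 x y t s u) * (∑ z', D z' w * ∑ u, |A u z'| * Hk z u) / (1 - lamA) : ℝ) +
          (∑ w, (∑ z', D z' w * ∑ u, |A u z'| * K3 x z u) * (∑ z', D z' w * ∑ u, |A u z'| * K4 y t s u) / (1 - lamA) : ℝ) +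
          (Real.sqrt (2 * K3 t s y * Real.sqrt (5 * (κ₂ ^ 4 * γop ^ 2) / (1 - lam * γop) ^ 2) * C3k) / Real.sqrt (ρ x y * ρ x z) : ℝ) +
          (∑ w, (∑ z', D z' w * ∑ u, |A u z'| * K5 x y z s u) * (∑ z', D z' w * ∑ u, |A u z'| * Hk t u) / (1 - lamA) : ℝ) +
          (∑ w, (∑ z', D z' w * ∑ u, |A u z'| * K3 x t u) * (∑ z', D z' w * ∑ u, |A u z'| * K4 y z s u) / (1 - lamA) : ℝ) +
          (Real.sqrt (2 * K3 z s y * Real.sqrt (5 * (κ₂ ^ 4 * γop ^ 2) / (1 - lam * γop) ^ 2) * C3k) / Real.sqrt (ρ x y * ρ x t) : ℝ) +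
          (∑ w, (∑ z', D z' w * ∑ u, |A u z'| * K5 x y z t u) * (∑ z', D z' w * ∑ u, |A u z'| * Hk s u) / (1 - lamA) : ℝ)) *
        (ϑ x y * ϑ x z * ϑ x t * ϑ x s * ϑ y z * ϑ y t * ϑ y s * ϑ z t * ϑ z s * ϑ t s) ≤
      k5ϑ4 + dθ * αk5m4 * (dθ' * αθc) / (1 - lamA) + dθ * αk5m4 * (dθ' * αθc) / (1 - lamA) + dθ * αk4m3 * (dθ' * αg1c) / (1 - lamA) + Real.sqrt
          (2 * Real.sqrt (5 * (κ₂ ^ 4 * γop ^ 2) / (1 - lam * γop) ^ 2) * C3k) * (Real.sqrt (k3mϑ * (Θ8 * Θ8)) * (G * G)) + dθ * αk5m4 *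
          (dθ' * αθc) / (1 - lamA) + dθ * αk4m3 * (dθ' * αg1c) / (1 - lamA) + Real.sqrt
          (2 * Real.sqrt (5 * (κ₂ ^ 4 * γop ^ 2) / (1 - lam * γop) ^ 2) * C3k) * (Real.sqrt (k3mϑ * (Θ8 * Θ8)) * (G * G)) + dθ * αθ * (dθ' * αk5c)
          / (1 - lamA) := by
  generalize Real.sqrt (5 * (κ₂ ^ 4 * γop ^ 2) / (1 - lam * γop) ^ 2) = sV
  have hl : 0 < 1 - lamA := by linarith
  have h0 : ∀ a b, 0 ≤ ϑ a b := fun a b => zero_le_one.trans (hϑ1 a b)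
  have h1 : ∀ a b, 1 ≤ ϑ a b := hϑ1
  have hϑ2k : ∀ a b (k : ℕ), k ≤ 4 → ϑ a b ^ k ≤ ϑ₂ a b := fun a b k hk => (pow_le_pow_right₀ (hϑ1 a b) hk).trans (hϑ4 a b)
  have hϑ12 : ∀ a b, ϑ a b ≤ ϑ₂ a b := fun a b => (pow_one (ϑ a b)).symm.trans_le (hϑ2k a b 1 (by norm_num))
  have hϑ₂0 : ∀ a b, 0 ≤ ϑ₂ a b := fun a b => (pow_nonneg (h0 a b) 4).trans (hϑ4 a b)
  have hϑ₂pos : ∀ a b, 0 < ϑ₂ a b := fun a b => lt_of_lt_of_le (pow_pos (lt_of_lt_of_le one_pos (hϑ1 a b)) 4) (hϑ4 a b)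
  have hsy : ∀ a b, ϑ a b = ϑ b a := hϑsymm
  have hm00 : ∀ a c b, ϑ a b ≤ ϑ a c * ϑ c b := fun a c b => hϑmul a c b
  have hm10 : ∀ a c b, ϑ a b ≤ ϑ c a * ϑ c b := fun a c b => by rw [hϑsymm c a]; exact hϑmul a c b
  have hϑsq : ∀ a b (k : ℕ), k * 2 ≤ 4 → (ϑ a b ^ k) ^ 2 ≤ ϑ₂ a b := fun a b k hk => by rw [← pow_mul]; exact hϑ2k a b (k * 2) hk
  have tnn : ∀ a b, 0 ≤ (ϑ a b ^ 4) ^ 2 / ϑ₂ a b := fun a b => div_nonneg (pow_nonneg (pow_nonneg (h0 a b) 4) 2) (hϑ₂0 a b)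
  have hT0 : 0 ≤ Θ8 := le_trans (Finset.sum_nonneg fun b _ => tnn s b) (hΘ s)
  have hG0 : 0 ≤ G := le_trans (Finset.sum_nonneg fun b _ => div_nonneg (pow_nonneg (h0 _ _) 6) (Real.sqrt_nonneg _)) (hG s)
  have hΘsy : ∀ a, ∑ b, (ϑ b a ^ 4) ^ 2 / ϑ₂ b a ≤ Θ8 := fun a => by simp_rw [hϑsymm _ a, hϑ₂symm _ a]; exact hΘ a
  have hGsy : ∀ a, ∑ b, ϑ a b ^ 6 / Real.sqrt (ρ b a) ≤ G := fun a => by simp_rw [hρsymm _ a]; exact hG a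
  have hxI : ∀ {c S T I : ℝ}, c ≤ S * T → 0 ≤ I → c * I ≤ S * (T * I) := fun h hI => by
    rw [← mul_assoc]; exact mul_le_mul_of_nonneg_right h hI
  have hσI : ∀ {S S₁ T I : ℝ}, S ≤ S₁ * T → 0 ≤ I → S * I ≤ S₁ * I * T := fun h hI => by
    rw [mul_right_comm]; exact mul_le_mul_of_nonneg_right h hI
  have hI3 : ∀ a b c, 0 ≤ ϑ₂ a b * ϑ₂ a c * ϑ₂ b c := fun a b c => mul_nonneg (mul_nonneg (hϑ₂0 a b) (hϑ₂0 a c)) (hϑ₂0 b c)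
  have hI6 : ∀ a b c d, 0 ≤ ϑ₂ a b * ϑ₂ a c * ϑ₂ a d * ϑ₂ b c * ϑ₂ b d * ϑ₂ c d := fun a b c d =>
    mul_nonneg (mul_nonneg (mul_nonneg (mul_nonneg (mul_nonneg (hϑ₂0 a b) (hϑ₂0 a c)) (hϑ₂0 a d)) (hϑ₂0 b c)) (hϑ₂0 b d)) (hϑ₂0 c d)
  have hF2 : ∀ a z', 0 ≤ ∑ u, |A u z'| * Hk a u := fun a z' => Finset.sum_nonneg fun u _ => mul_nonneg (abs_nonneg _) (hHk0 a u)
  have hF3 : ∀ a b z', 0 ≤ ∑ u, |A u z'| * K3 a b u := fun a b z' => Finset.sum_nonneg fun u _ => mul_nonneg (abs_nonneg _) (hK30 a b u)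
  have hF4 : ∀ a b c z', 0 ≤ ∑ u, |A u z'| * K4 a b c u := fun a b c z' => Finset.sum_nonneg fun u _ => mul_nonneg (abs_nonneg _) (hK40 a b c u)
  have hF5 : ∀ a b c d z', 0 ≤ ∑ u, |A u z'| * K5 a b c d u := fun a b c d z' =>
    Finset.sum_nonneg fun u _ => mul_nonneg (abs_nonneg _) (hK50 a b c d u)
  have hE : ∀ {F G : κ → ℝ}, (∀ z', 0 ≤ F z') → (∀ z', 0 ≤ G z') →
      0 ≤ ∑ w, (∑ z', D z' w * F z') * (∑ z', D z' w * G z') / (1 - lamA) := fun hF hG => Finset.sum_nonneg fun w _ =>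
    div_nonneg
        (mul_nonneg (Finset.sum_nonneg fun z' _ => mul_nonneg (hD z' w) (hF z')) (Finset.sum_nonneg fun z' _ => mul_nonneg (hD z' w) (hG z')))
        hl.le
  have tm0 : ∑ x, ∑ y, ∑ z, ∑ t, ((K5 y z t s x : ℝ)) * (ϑ x y * ϑ x z * ϑ x t * ϑ x s * ϑ y z * ϑ y t * ϑ y s * ϑ z t * ϑ z s * ϑ t s) ≤ k5ϑ4 :=
      by
    exact (Finset.sum_le_sum fun x _ => Finset.sum_le_sum fun y _ => Finset.sum_le_sum fun z _ => Finset.sum_le_sum fun t _ =>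
      mul_le_mul_of_nonneg_left
          (prod10_le (hϑ12 x y) (hϑ12 x z) (hϑ12 x t) (hϑ12 x s) (hϑ12 y z) (hϑ12 y t) (hϑ12 y s) (hϑ12 z t) (hϑ12 z s) (hϑ12 t s) (h0 _ _)
            (h0 _ _) (h0 _ _) (h0 _ _) (h0 _ _) (h0 _ _) (h0 _ _) (h0 _ _) (h0 _ _) (h0 _ _)) (hK50 y z t s x)).trans (hk5 s)
  have tm1 : ∑ x, ∑ y, ∑ z, ∑ t, ((∑ w, (∑ z', D z' w * ∑ u, |A u z'| * Hk x u) * (∑ z', D z' w * ∑ u, |A u z'| * K5 y z t s u) / (1 - lamA) : ℝ))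
      * (ϑ x y * ϑ x z * ϑ x t * ϑ x s * ϑ y z * ϑ y t * ϑ y s * ϑ z t * ϑ z s * ϑ t s) ≤ dθ * αk5m4 * (dθ' * αθc) / (1 - lamA) := by
    have hw : ∀ x y z t : ι, ϑ x y * ϑ x z * ϑ x t * ϑ x s * ϑ y z * ϑ y t * ϑ y s * ϑ z t * ϑ z s * ϑ t s ≤ ϑ₂ s y * ϑ₂ s z * ϑ₂ s t * ϑ₂ y z *
        ϑ₂ y t * ϑ₂ z t * (ϑ s x ^ 6) := fun x y z t =>
      ((prod10_le ((hm10 x s y)) ((hm10 x s z)) ((hm10 x s t)) ((hsy x s).le) le_rfl le_rfl ((hsy y s).le) le_rfl ((hsy z s).le) ((hsy t s).le)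
              (h0 _ _) (h0 _ _) (h0 _ _) (h0 _ _) (h0 _ _) (h0 _ _) (h0 _ _) (h0 _ _) (h0 _ _) (h0 _ _)).trans_eq (by ring)).trans
          (mul_le_mul
            (mul_le_mul
              (mul_le_mul
                (mul_le_mul
                  (mul_le_mul (mul_le_mul (hϑ2k s y 2 (by norm_num)) (hϑ2k s z 2 (by norm_num)) (pow_nonneg (h0 _ _) _) (hϑ₂0 _ _))
                    (hϑ2k s t 2 (by norm_num)) (pow_nonneg (h0 _ _) _) (mul_nonneg (hϑ₂0 _ _) (hϑ₂0 _ _))) (hϑ2k y z 1 (by norm_num))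
                  (pow_nonneg (h0 _ _) _) (mul_nonneg (mul_nonneg (hϑ₂0 _ _) (hϑ₂0 _ _)) (hϑ₂0 _ _))) (hϑ2k y t 1 (by norm_num))
                (pow_nonneg (h0 _ _) _) (mul_nonneg (mul_nonneg (mul_nonneg (hϑ₂0 _ _) (hϑ₂0 _ _)) (hϑ₂0 _ _)) (hϑ₂0 _ _)))
              (hϑ2k z t 1 (by norm_num)) (pow_nonneg (h0 _ _) _)
              (mul_nonneg (mul_nonneg (mul_nonneg (mul_nonneg (hϑ₂0 _ _) (hϑ₂0 _ _)) (hϑ₂0 _ _)) (hϑ₂0 _ _)) (hϑ₂0 _ _)))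
            (pow_le_pow_right₀ (h1 s x) (by norm_num : 4 ≤ 6)) (pow_nonneg (h0 _ _) _)
            (mul_nonneg (mul_nonneg (mul_nonneg (mul_nonneg (mul_nonneg (hϑ₂0 _ _) (hϑ₂0 _ _)) (hϑ₂0 _ _)) (hϑ₂0 _ _)) (hϑ₂0 _ _)) (hϑ₂0 _ _)))
    have h := weighted_two_point_two_families_le (R := ι × ι × ι) (S := ι) (αm := αk5m4) (g := fun r z' => ∑ u, |A u z'| * K5 r.1 r.2.1 r.2.2 s u)
        (α := fun r => ϑ₂ s r.1 * ϑ₂ s r.2.1 * ϑ₂ s r.2.2 * ϑ₂ r.1 r.2.1 * ϑ₂ r.1 r.2.2 * ϑ₂ r.2.1 r.2.2)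
        (b := fun q z' => ∑ u, |A u z'| * Hk q u) (σ := fun w => σ s w) (σ₁ := fun z' => σ s z') (σ' := fun q w => σ q w)
        (σ'₁ := fun q z' => σ q z') (β := fun q => ϑ s q ^ 6) (fun r z' => hF5 r.1 r.2.1 r.2.2 s z') (fun r => (hI6 s r.1 r.2.1 r.2.2))
        (fun q z' => hF2 q z') hD hθnn (fun w => hσ0 s w) (fun z' => hσ0 s z') (fun q w => hϑσ6 s q w) (fun z' w => hσθ s z' w)
        (fun q z' w => hσθ q z' w) hDθr hdθ hDθc hdθ' (by simpa only [Fintype.sum_prod_type] using hk5m4 s) (hbσc) hαθc hlamA1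
    simp only [Fintype.sum_prod_type] at h
    refine (sum4_perm_1230 _).trans_le ?_
    refine le_trans ?_ h
    exact Finset.sum_le_sum fun y _ => Finset.sum_le_sum fun z _ => Finset.sum_le_sum fun t _ => Finset.sum_le_sum fun x _ =>
      mul_le_mul_of_nonneg_left (hw x y z t) (hE (hF2 x) (hF5 y z t s))
  have tm2 : ∑ x, ∑ y, ∑ z, ∑ t, ((∑ w, (∑ z', D z' w * ∑ u, |A u z'| * K5 x y t s u) * (∑ z', D z' w * ∑ u, |A u z'| * Hk z u) / (1 - lamA) : ℝ))
      * (ϑ x y * ϑ x z * ϑ x t * ϑ x s * ϑ y z * ϑ y t * ϑ y s * ϑ z t * ϑ z s * ϑ t s) ≤ dθ * αk5m4 * (dθ' * αθc) / (1 - lamA) := by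
    have hw : ∀ x y z t : ι, ϑ x y * ϑ x z * ϑ x t * ϑ x s * ϑ y z * ϑ y t * ϑ y s * ϑ z t * ϑ z s * ϑ t s ≤ ϑ₂ s x * ϑ₂ s y * ϑ₂ s t * ϑ₂ x y *
        ϑ₂ x t * ϑ₂ y t * (ϑ s z ^ 6) := fun x y z t =>
      ((prod10_le le_rfl ((hm10 x s z)) le_rfl ((hsy x s).le) ((hm10 y s z)) le_rfl ((hsy y s).le) ((hm10 z s t)) ((hsy z s).le) ((hsy t s).le)
              (h0 _ _) (h0 _ _) (h0 _ _) (h0 _ _) (h0 _ _) (h0 _ _) (h0 _ _) (h0 _ _) (h0 _ _) (h0 _ _)).trans_eq (by ring)).trans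
          (mul_le_mul
            (mul_le_mul
              (mul_le_mul
                (mul_le_mul
                  (mul_le_mul (mul_le_mul (hϑ2k s x 2 (by norm_num)) (hϑ2k s y 2 (by norm_num)) (pow_nonneg (h0 _ _) _) (hϑ₂0 _ _))
                    (hϑ2k s t 2 (by norm_num)) (pow_nonneg (h0 _ _) _) (mul_nonneg (hϑ₂0 _ _) (hϑ₂0 _ _))) (hϑ2k x y 1 (by norm_num))
                  (pow_nonneg (h0 _ _) _) (mul_nonneg (mul_nonneg (hϑ₂0 _ _) (hϑ₂0 _ _)) (hϑ₂0 _ _))) (hϑ2k x t 1 (by norm_num))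
                (pow_nonneg (h0 _ _) _) (mul_nonneg (mul_nonneg (mul_nonneg (hϑ₂0 _ _) (hϑ₂0 _ _)) (hϑ₂0 _ _)) (hϑ₂0 _ _)))
              (hϑ2k y t 1 (by norm_num)) (pow_nonneg (h0 _ _) _)
              (mul_nonneg (mul_nonneg (mul_nonneg (mul_nonneg (hϑ₂0 _ _) (hϑ₂0 _ _)) (hϑ₂0 _ _)) (hϑ₂0 _ _)) (hϑ₂0 _ _)))
            (pow_le_pow_right₀ (h1 s z) (by norm_num : 4 ≤ 6)) (pow_nonneg (h0 _ _) _)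
            (mul_nonneg (mul_nonneg (mul_nonneg (mul_nonneg (mul_nonneg (hϑ₂0 _ _) (hϑ₂0 _ _)) (hϑ₂0 _ _)) (hϑ₂0 _ _)) (hϑ₂0 _ _)) (hϑ₂0 _ _)))
    have h := weighted_two_point_two_families_le' (R := ι × ι × ι) (S := ι) (αm := αk5m4)
        (g := fun r z' => ∑ u, |A u z'| * K5 r.1 r.2.1 r.2.2 s u)
        (α := fun r => ϑ₂ s r.1 * ϑ₂ s r.2.1 * ϑ₂ s r.2.2 * ϑ₂ r.1 r.2.1 * ϑ₂ r.1 r.2.2 * ϑ₂ r.2.1 r.2.2)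
        (b := fun q z' => ∑ u, |A u z'| * Hk q u) (σ := fun w => σ s w) (σ₁ := fun z' => σ s z') (σ' := fun q w => σ q w)
        (σ'₁ := fun q z' => σ q z') (β := fun q => ϑ s q ^ 6) (fun r z' => hF5 r.1 r.2.1 r.2.2 s z') (fun r => (hI6 s r.1 r.2.1 r.2.2))
        (fun q z' => hF2 q z') hD hθnn (fun w => hσ0 s w) (fun z' => hσ0 s z') (fun q w => hϑσ6 s q w) (fun z' w => hσθ s z' w)
        (fun q z' w => hσθ q z' w) hDθr hdθ hDθc hdθ' (by simpa only [Fintype.sum_prod_type] using hk5m4 s) (hbσc) hαθc hlamA1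
    simp only [Fintype.sum_prod_type] at h
    refine (sum4_perm_0132 _).trans_le ?_
    refine le_trans ?_ h
    exact Finset.sum_le_sum fun x _ => Finset.sum_le_sum fun y _ => Finset.sum_le_sum fun t _ => Finset.sum_le_sum fun z _ =>
      mul_le_mul_of_nonneg_left (hw x y z t) (hE (hF5 x y t s) (hF2 z))
  have tm3 : ∑ x, ∑ y, ∑ z, ∑ t, ((∑ w, (∑ z', D z' w * ∑ u, |A u z'| * K3 x z u) * (∑ z', D z' w * ∑ u, |A u z'| * K4 y t s u) / (1 - lamA) : ℝ))
      * (ϑ x y * ϑ x z * ϑ x t * ϑ x s * ϑ y z * ϑ y t * ϑ y s * ϑ z t * ϑ z s * ϑ t s) ≤ dθ * αk4m3 * (dθ' * αg1c) / (1 - lamA) := by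
    have hw : ∀ x y z t : ι, ϑ x y * ϑ x z * ϑ x t * ϑ x s * ϑ y z * ϑ y t * ϑ y s * ϑ z t * ϑ z s * ϑ t s ≤ ϑ₂ s y * ϑ₂ s t * ϑ₂ y t *
        (ϑ s x ^ 6 * (ϑ₂ x z)) := fun x y z t =>
      ((prod10_le ((hm10 x s y)) le_rfl ((hm10 x s t)) ((hsy x s).le) (((hm10 y s z).trans (mul_le_mul_of_nonneg_left (hm00 s x z) (h0 _ _))))
              le_rfl ((hsy y s).le) (((hm10 z x t).trans (mul_le_mul_of_nonneg_left (hm10 x s t) (h0 _ _))))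
              (((hm10 z x s).trans (mul_le_mul_of_nonneg_left (hsy x s).le (h0 _ _)))) ((hsy t s).le) (h0 _ _) (h0 _ _) (h0 _ _) (h0 _ _) (h0 _ _)
              (h0 _ _) (h0 _ _) (h0 _ _) (h0 _ _) (h0 _ _)).trans_eq (by ring)).trans
          (mul_le_mul
            (mul_le_mul (mul_le_mul (hϑ2k s y 3 (by norm_num)) (hϑ2k s t 3 (by norm_num)) (pow_nonneg (h0 _ _) _) (hϑ₂0 _ _))
              (hϑ2k y t 1 (by norm_num)) (pow_nonneg (h0 _ _) _) (mul_nonneg (hϑ₂0 _ _) (hϑ₂0 _ _)))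
            (mul_le_mul (pow_le_pow_right₀ (h1 s x) (by norm_num : 6 ≤ 6)) (hϑ2k x z 4 (by norm_num)) (pow_nonneg (h0 x z) 4)
              (pow_nonneg (h0 _ _) _)) (mul_nonneg (pow_nonneg (h0 _ _) _) (pow_nonneg (h0 x z) 4))
            (mul_nonneg (mul_nonneg (hϑ₂0 _ _) (hϑ₂0 _ _)) (hϑ₂0 _ _)))
    have h := weighted_two_point_two_families_le (R := ι × ι) (S := ι × ι) (αm := αk4m3) (g := fun r z' => ∑ u, |A u z'| * K4 r.1 r.2 s u)
        (α := fun r => ϑ₂ s r.1 * ϑ₂ s r.2 * ϑ₂ r.1 r.2) (b := fun q z' => ∑ u, |A u z'| * K3 q.1 q.2 u) (σ := fun w => σ s w)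
        (σ₁ := fun z' => σ s z') (σ' := fun q w => σ q.1 w * (ϑ₂ q.1 q.2)) (σ'₁ := fun q z' => σ q.1 z' * (ϑ₂ q.1 q.2))
        (β := fun q => ϑ s q.1 ^ 6 * (ϑ₂ q.1 q.2)) (fun r z' => hF4 r.1 r.2 s z') (fun r => (hI3 s r.1 r.2)) (fun q z' => hF3 q.1 q.2 z') hD hθnn
        (fun w => hσ0 s w) (fun z' => hσ0 s z') (fun q w => hxI (hϑσ6 s q.1 w) (hϑ₂0 q.1 q.2)) (fun z' w => hσθ s z' w)
        (fun q z' w => hσI (hσθ q.1 z' w) (hϑ₂0 q.1 q.2)) hDθr hdθ hDθc hdθ' (by simpa only [Fintype.sum_prod_type] using hk4m3 s)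
        (fun z' => by simpa only [Fintype.sum_prod_type] using hg1c z') hαg1c hlamA1
    simp only [Fintype.sum_prod_type] at h
    refine (sum4_perm_1302 _).trans_le ?_
    refine le_trans ?_ h
    exact Finset.sum_le_sum fun y _ => Finset.sum_le_sum fun t _ => Finset.sum_le_sum fun x _ => Finset.sum_le_sum fun z _ =>
      mul_le_mul_of_nonneg_left (hw x y z t) (hE (hF3 x z) (hF4 y t s))
  have tm4 : ∑ x, ∑ y, ∑ z, ∑ t, ((Real.sqrt (2 * K3 t s y * sV * C3k) / Real.sqrt (ρ x y * ρ x z) : ℝ)) *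
      (ϑ x y * ϑ x z * ϑ x t * ϑ x s * ϑ y z * ϑ y t * ϑ y s * ϑ z t * ϑ z s * ϑ t s) ≤ Real.sqrt (2 * sV * C3k) *
      (Real.sqrt (k3mϑ * (Θ8 * Θ8)) * (G * G)) := by
    have hw : ∀ x y z t : ι, ϑ x y * ϑ x z * ϑ x t * ϑ x s * ϑ y z * ϑ y t * ϑ y s * ϑ z t * ϑ z s * ϑ t s ≤ ϑ y x ^ 6 * ϑ x z ^ 4 * ϑ t y ^ 3 * ϑ
        s y ^ 3 * ϑ s t ^ 1 := fun x y z t =>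
      (prod10_le ((hsy x y).le) le_rfl (((hm10 x y t).trans (mul_le_mul_of_nonneg_left (hsy y t).le (h0 _ _))))
            (((hm10 x y s).trans (mul_le_mul_of_nonneg_left (hsy y s).le (h0 _ _)))) ((hm00 y x z)) ((hsy y t).le) ((hsy y s).le)
            (((hm10 z x t).trans (mul_le_mul_of_nonneg_left ((hm10 x y t).trans (mul_le_mul_of_nonneg_left (hsy y t).le (h0 _ _))) (h0 _ _))))
            (((hm10 z x s).trans (mul_le_mul_of_nonneg_left ((hm10 x y s).trans (mul_le_mul_of_nonneg_left (hsy y s).le (h0 _ _))) (h0 _ _))))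
            ((hsy t s).le) (h0 _ _) (h0 _ _) (h0 _ _) (h0 _ _) (h0 _ _) (h0 _ _) (h0 _ _) (h0 _ _) (h0 _ _) (h0 _ _)).trans_eq (by ring)
    refine (sum4_perm_3102 _).trans_le ?_
    have hKK0 : 0 ≤ Real.sqrt (2 * sV * C3k) := (Real.sqrt_nonneg _)
    have hpw : ∀ x y z t : ι, ((Real.sqrt (2 * K3 t s y * sV * C3k) / Real.sqrt (ρ x y * ρ x z) : ℝ)) *
        (ϑ x y * ϑ x z * ϑ x t * ϑ x s * ϑ y z * ϑ y t * ϑ y s * ϑ z t * ϑ z s * ϑ t s) ≤ Real.sqrt (2 * sV * C3k) *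
        (Real.sqrt (K3 t s y) * (ϑ s t ^ 1 * ϑ s y ^ 3 * ϑ t y ^ 3) * ((ϑ y x ^ 6 / Real.sqrt (ρ x y)) * (ϑ x z ^ 4 / Real.sqrt (ρ x z)))) := fun
        x y z t =>
      (mul_le_mul_of_nonneg_left (hw x y z t) (div_nonneg (Real.sqrt_nonneg _) (Real.sqrt_nonneg _))).trans_eq
          (by rw [sqrt_split3 (hK30 t s y), Real.sqrt_mul (hρ0 x y).le]; ring)
    refine le_trans
        (Finset.sum_le_sum fun t _ => Finset.sum_le_sum fun y _ => Finset.sum_le_sum fun x _ => Finset.sum_le_sum fun z _ => hpw x y z t) ?_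
    exact sum4_le_pair_first (K := Real.sqrt (2 * sV * C3k)) (e := fun t y => Real.sqrt (K3 t s y) * (ϑ s t ^ 1 * ϑ s y ^ 3 * ϑ t y ^ 3))
        (a := fun t y x => ϑ y x ^ 6 / Real.sqrt (ρ x y)) (b := fun t y x z => ϑ x z ^ 4 / Real.sqrt (ρ x z)) hKK0
        (fun t y =>
          (mul_nonneg (Real.sqrt_nonneg _) (mul_nonneg (mul_nonneg (pow_nonneg (h0 _ _) _) (pow_nonneg (h0 _ _) _)) (pow_nonneg (h0 _ _) _))))
        (fun t y x => (div_nonneg (pow_nonneg (h0 _ _) _) (Real.sqrt_nonneg _))) hG0 hG0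
        (sum2_sqrt_mul_le_letters' (a := fun t y => K3 t s y) (c := fun t y => ϑ s t ^ 1 * ϑ s y ^ 3 * ϑ t y ^ 3)
          (θ := fun t y => ϑ₂ s t * ϑ₂ s y * ϑ₂ t y) (fun t y => hK30 _ _ _)
          (fun t y => mul_nonneg (mul_nonneg (pow_nonneg (h0 _ _) _) (pow_nonneg (h0 _ _) _)) (pow_nonneg (h0 _ _) _))
          (fun t y => mul_pos (mul_pos (hϑ₂pos _ _) (hϑ₂pos _ _)) (hϑ₂pos _ _)) (hk3m s)
          ((Finset.sum_le_sum fun t _ => Finset.sum_le_sum fun y _ => pmono_first (h1 s t) (h1 s y) (h1 t y) (hϑ₂pos s t) (hϑ₂pos s y)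
              (hϑ₂pos t y) (hϑsq s t 1 (by norm_num)) (by norm_num : 3 ≤ 4) (by norm_num : 3 ≤ 4)).trans
            (geom_first (fun y => tnn s y) (fun y => hΘsy y) (hΘ s) hT0)))
        (fun t y => ((Finset.sum_le_sum fun x _ => rmono (h1 y x) (hρ0 x y) (by norm_num : 6 ≤ 6)).trans (hGsy y)))
        (fun t y x => ((Finset.sum_le_sum fun z _ => rmono (h1 x z) (hρ0 x z) (by norm_num : 4 ≤ 6)).trans (hG x)))
  have tm5 : ∑ x, ∑ y, ∑ z, ∑ t, ((∑ w, (∑ z', D z' w * ∑ u, |A u z'| * K5 x y z s u) * (∑ z', D z' w * ∑ u, |A u z'| * Hk t u) / (1 - lamA) : ℝ))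
      * (ϑ x y * ϑ x z * ϑ x t * ϑ x s * ϑ y z * ϑ y t * ϑ y s * ϑ z t * ϑ z s * ϑ t s) ≤ dθ * αk5m4 * (dθ' * αθc) / (1 - lamA) := by
    have hw : ∀ x y z t : ι, ϑ x y * ϑ x z * ϑ x t * ϑ x s * ϑ y z * ϑ y t * ϑ y s * ϑ z t * ϑ z s * ϑ t s ≤ ϑ₂ s x * ϑ₂ s y * ϑ₂ s z * ϑ₂ x y *
        ϑ₂ x z * ϑ₂ y z * (ϑ s t ^ 6) := fun x y z t =>
      ((prod10_le le_rfl le_rfl ((hm10 x s t)) ((hsy x s).le) le_rfl ((hm10 y s t)) ((hsy y s).le) ((hm10 z s t)) ((hsy z s).le) ((hsy t s).le)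
              (h0 _ _) (h0 _ _) (h0 _ _) (h0 _ _) (h0 _ _) (h0 _ _) (h0 _ _) (h0 _ _) (h0 _ _) (h0 _ _)).trans_eq (by ring)).trans
          (mul_le_mul
            (mul_le_mul
              (mul_le_mul
                (mul_le_mul
                  (mul_le_mul (mul_le_mul (hϑ2k s x 2 (by norm_num)) (hϑ2k s y 2 (by norm_num)) (pow_nonneg (h0 _ _) _) (hϑ₂0 _ _))
                    (hϑ2k s z 2 (by norm_num)) (pow_nonneg (h0 _ _) _) (mul_nonneg (hϑ₂0 _ _) (hϑ₂0 _ _))) (hϑ2k x y 1 (by norm_num))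
                  (pow_nonneg (h0 _ _) _) (mul_nonneg (mul_nonneg (hϑ₂0 _ _) (hϑ₂0 _ _)) (hϑ₂0 _ _))) (hϑ2k x z 1 (by norm_num))
                (pow_nonneg (h0 _ _) _) (mul_nonneg (mul_nonneg (mul_nonneg (hϑ₂0 _ _) (hϑ₂0 _ _)) (hϑ₂0 _ _)) (hϑ₂0 _ _)))
              (hϑ2k y z 1 (by norm_num)) (pow_nonneg (h0 _ _) _)
              (mul_nonneg (mul_nonneg (mul_nonneg (mul_nonneg (hϑ₂0 _ _) (hϑ₂0 _ _)) (hϑ₂0 _ _)) (hϑ₂0 _ _)) (hϑ₂0 _ _)))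
            (pow_le_pow_right₀ (h1 s t) (by norm_num : 4 ≤ 6)) (pow_nonneg (h0 _ _) _)
            (mul_nonneg (mul_nonneg (mul_nonneg (mul_nonneg (mul_nonneg (hϑ₂0 _ _) (hϑ₂0 _ _)) (hϑ₂0 _ _)) (hϑ₂0 _ _)) (hϑ₂0 _ _)) (hϑ₂0 _ _)))
    have h := weighted_two_point_two_families_le' (R := ι × ι × ι) (S := ι) (αm := αk5m4)
        (g := fun r z' => ∑ u, |A u z'| * K5 r.1 r.2.1 r.2.2 s u)
        (α := fun r => ϑ₂ s r.1 * ϑ₂ s r.2.1 * ϑ₂ s r.2.2 * ϑ₂ r.1 r.2.1 * ϑ₂ r.1 r.2.2 * ϑ₂ r.2.1 r.2.2)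
        (b := fun q z' => ∑ u, |A u z'| * Hk q u) (σ := fun w => σ s w) (σ₁ := fun z' => σ s z') (σ' := fun q w => σ q w)
        (σ'₁ := fun q z' => σ q z') (β := fun q => ϑ s q ^ 6) (fun r z' => hF5 r.1 r.2.1 r.2.2 s z') (fun r => (hI6 s r.1 r.2.1 r.2.2))
        (fun q z' => hF2 q z') hD hθnn (fun w => hσ0 s w) (fun z' => hσ0 s z') (fun q w => hϑσ6 s q w) (fun z' w => hσθ s z' w)
        (fun q z' w => hσθ q z' w) hDθr hdθ hDθc hdθ' (by simpa only [Fintype.sum_prod_type] using hk5m4 s) (hbσc) hαθc hlamA1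
    simp only [Fintype.sum_prod_type] at h
    refine le_trans ?_ h
    exact Finset.sum_le_sum fun x _ => Finset.sum_le_sum fun y _ => Finset.sum_le_sum fun z _ => Finset.sum_le_sum fun t _ =>
      mul_le_mul_of_nonneg_left (hw x y z t) (hE (hF5 x y z s) (hF2 t))
  have tm6 : ∑ x, ∑ y, ∑ z, ∑ t, ((∑ w, (∑ z', D z' w * ∑ u, |A u z'| * K3 x t u) * (∑ z', D z' w * ∑ u, |A u z'| * K4 y z s u) / (1 - lamA) : ℝ))
      * (ϑ x y * ϑ x z * ϑ x t * ϑ x s * ϑ y z * ϑ y t * ϑ y s * ϑ z t * ϑ z s * ϑ t s) ≤ dθ * αk4m3 * (dθ' * αg1c) / (1 - lamA) := by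
    have hw : ∀ x y z t : ι, ϑ x y * ϑ x z * ϑ x t * ϑ x s * ϑ y z * ϑ y t * ϑ y s * ϑ z t * ϑ z s * ϑ t s ≤ ϑ₂ s y * ϑ₂ s z * ϑ₂ y z *
        (ϑ s x ^ 6 * (ϑ₂ x t)) := fun x y z t =>
      ((prod10_le ((hm10 x s y)) ((hm10 x s z)) le_rfl ((hsy x s).le) le_rfl
              (((hm10 y s t).trans (mul_le_mul_of_nonneg_left (hm00 s x t) (h0 _ _)))) ((hsy y s).le)
              (((hm10 z s t).trans (mul_le_mul_of_nonneg_left (hm00 s x t) (h0 _ _)))) ((hsy z s).le)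
              (((hm10 t x s).trans (mul_le_mul_of_nonneg_left (hsy x s).le (h0 _ _)))) (h0 _ _) (h0 _ _) (h0 _ _) (h0 _ _) (h0 _ _) (h0 _ _)
              (h0 _ _) (h0 _ _) (h0 _ _) (h0 _ _)).trans_eq (by ring)).trans
          (mul_le_mul
            (mul_le_mul (mul_le_mul (hϑ2k s y 3 (by norm_num)) (hϑ2k s z 3 (by norm_num)) (pow_nonneg (h0 _ _) _) (hϑ₂0 _ _))
              (hϑ2k y z 1 (by norm_num)) (pow_nonneg (h0 _ _) _) (mul_nonneg (hϑ₂0 _ _) (hϑ₂0 _ _)))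
            (mul_le_mul (pow_le_pow_right₀ (h1 s x) (by norm_num : 6 ≤ 6)) (hϑ2k x t 4 (by norm_num)) (pow_nonneg (h0 x t) 4)
              (pow_nonneg (h0 _ _) _)) (mul_nonneg (pow_nonneg (h0 _ _) _) (pow_nonneg (h0 x t) 4))
            (mul_nonneg (mul_nonneg (hϑ₂0 _ _) (hϑ₂0 _ _)) (hϑ₂0 _ _)))
    have h := weighted_two_point_two_families_le (R := ι × ι) (S := ι × ι) (αm := αk4m3) (g := fun r z' => ∑ u, |A u z'| * K4 r.1 r.2 s u)
        (α := fun r => ϑ₂ s r.1 * ϑ₂ s r.2 * ϑ₂ r.1 r.2) (b := fun q z' => ∑ u, |A u z'| * K3 q.1 q.2 u) (σ := fun w => σ s w)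
        (σ₁ := fun z' => σ s z') (σ' := fun q w => σ q.1 w * (ϑ₂ q.1 q.2)) (σ'₁ := fun q z' => σ q.1 z' * (ϑ₂ q.1 q.2))
        (β := fun q => ϑ s q.1 ^ 6 * (ϑ₂ q.1 q.2)) (fun r z' => hF4 r.1 r.2 s z') (fun r => (hI3 s r.1 r.2)) (fun q z' => hF3 q.1 q.2 z') hD hθnn
        (fun w => hσ0 s w) (fun z' => hσ0 s z') (fun q w => hxI (hϑσ6 s q.1 w) (hϑ₂0 q.1 q.2)) (fun z' w => hσθ s z' w)
        (fun q z' w => hσI (hσθ q.1 z' w) (hϑ₂0 q.1 q.2)) hDθr hdθ hDθc hdθ' (by simpa only [Fintype.sum_prod_type] using hk4m3 s)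
        (fun z' => by simpa only [Fintype.sum_prod_type] using hg1c z') hαg1c hlamA1
    simp only [Fintype.sum_prod_type] at h
    refine (sum4_perm_1203 _).trans_le ?_
    refine le_trans ?_ h
    exact Finset.sum_le_sum fun y _ => Finset.sum_le_sum fun z _ => Finset.sum_le_sum fun x _ => Finset.sum_le_sum fun t _ =>
      mul_le_mul_of_nonneg_left (hw x y z t) (hE (hF3 x t) (hF4 y z s))
  have tm7 : ∑ x, ∑ y, ∑ z, ∑ t, ((Real.sqrt (2 * K3 z s y * sV * C3k) / Real.sqrt (ρ x y * ρ x t) : ℝ)) *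
      (ϑ x y * ϑ x z * ϑ x t * ϑ x s * ϑ y z * ϑ y t * ϑ y s * ϑ z t * ϑ z s * ϑ t s) ≤ Real.sqrt (2 * sV * C3k) *
      (Real.sqrt (k3mϑ * (Θ8 * Θ8)) * (G * G)) := by
    have hw : ∀ x y z t : ι, ϑ x y * ϑ x z * ϑ x t * ϑ x s * ϑ y z * ϑ y t * ϑ y s * ϑ z t * ϑ z s * ϑ t s ≤ ϑ y x ^ 6 * ϑ x t ^ 4 * ϑ z y ^ 3 * ϑ
        s y ^ 3 * ϑ s z ^ 1 := fun x y z t =>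
      (prod10_le ((hsy x y).le) (((hm10 x y z).trans (mul_le_mul_of_nonneg_left (hsy y z).le (h0 _ _)))) le_rfl
            (((hm10 x y s).trans (mul_le_mul_of_nonneg_left (hsy y s).le (h0 _ _)))) ((hsy y z).le) ((hm00 y x t)) ((hsy y s).le)
            (((hm00 z y t).trans (mul_le_mul_of_nonneg_left (hm00 y x t) (h0 _ _)))) ((hsy z s).le)
            (((hm10 t x s).trans (mul_le_mul_of_nonneg_left ((hm10 x y s).trans (mul_le_mul_of_nonneg_left (hsy y s).le (h0 _ _))) (h0 _ _))))
            (h0 _ _) (h0 _ _) (h0 _ _) (h0 _ _) (h0 _ _) (h0 _ _) (h0 _ _) (h0 _ _) (h0 _ _) (h0 _ _)).trans_eq (by ring)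
    refine (sum4_perm_2103 _).trans_le ?_
    have hKK0 : 0 ≤ Real.sqrt (2 * sV * C3k) := (Real.sqrt_nonneg _)
    have hpw : ∀ x y z t : ι, ((Real.sqrt (2 * K3 z s y * sV * C3k) / Real.sqrt (ρ x y * ρ x t) : ℝ)) *
        (ϑ x y * ϑ x z * ϑ x t * ϑ x s * ϑ y z * ϑ y t * ϑ y s * ϑ z t * ϑ z s * ϑ t s) ≤ Real.sqrt (2 * sV * C3k) *
        (Real.sqrt (K3 z s y) * (ϑ s z ^ 1 * ϑ s y ^ 3 * ϑ z y ^ 3) * ((ϑ y x ^ 6 / Real.sqrt (ρ x y)) * (ϑ x t ^ 4 / Real.sqrt (ρ x t)))) := fun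
        x y z t =>
      (mul_le_mul_of_nonneg_left (hw x y z t) (div_nonneg (Real.sqrt_nonneg _) (Real.sqrt_nonneg _))).trans_eq
          (by rw [sqrt_split3 (hK30 z s y), Real.sqrt_mul (hρ0 x y).le]; ring)
    refine le_trans
        (Finset.sum_le_sum fun z _ => Finset.sum_le_sum fun y _ => Finset.sum_le_sum fun x _ => Finset.sum_le_sum fun t _ => hpw x y z t) ?_
    exact sum4_le_pair_first (K := Real.sqrt (2 * sV * C3k)) (e := fun z y => Real.sqrt (K3 z s y) * (ϑ s z ^ 1 * ϑ s y ^ 3 * ϑ z y ^ 3))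
        (a := fun z y x => ϑ y x ^ 6 / Real.sqrt (ρ x y)) (b := fun z y x t => ϑ x t ^ 4 / Real.sqrt (ρ x t)) hKK0
        (fun z y =>
          (mul_nonneg (Real.sqrt_nonneg _) (mul_nonneg (mul_nonneg (pow_nonneg (h0 _ _) _) (pow_nonneg (h0 _ _) _)) (pow_nonneg (h0 _ _) _))))
        (fun z y x => (div_nonneg (pow_nonneg (h0 _ _) _) (Real.sqrt_nonneg _))) hG0 hG0
        (sum2_sqrt_mul_le_letters' (a := fun z y => K3 z s y) (c := fun z y => ϑ s z ^ 1 * ϑ s y ^ 3 * ϑ z y ^ 3)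
          (θ := fun z y => ϑ₂ s z * ϑ₂ s y * ϑ₂ z y) (fun z y => hK30 _ _ _)
          (fun z y => mul_nonneg (mul_nonneg (pow_nonneg (h0 _ _) _) (pow_nonneg (h0 _ _) _)) (pow_nonneg (h0 _ _) _))
          (fun z y => mul_pos (mul_pos (hϑ₂pos _ _) (hϑ₂pos _ _)) (hϑ₂pos _ _)) (hk3m s)
          ((Finset.sum_le_sum fun z _ => Finset.sum_le_sum fun y _ => pmono_first (h1 s z) (h1 s y) (h1 z y) (hϑ₂pos s z) (hϑ₂pos s y)
              (hϑ₂pos z y) (hϑsq s z 1 (by norm_num)) (by norm_num : 3 ≤ 4) (by norm_num : 3 ≤ 4)).trans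
            (geom_first (fun y => tnn s y) (fun y => hΘsy y) (hΘ s) hT0)))
        (fun z y => ((Finset.sum_le_sum fun x _ => rmono (h1 y x) (hρ0 x y) (by norm_num : 6 ≤ 6)).trans (hGsy y)))
        (fun z y x => ((Finset.sum_le_sum fun t _ => rmono (h1 x t) (hρ0 x t) (by norm_num : 4 ≤ 6)).trans (hG x)))
  have tm8 : ∑ x, ∑ y, ∑ z, ∑ t, ((∑ w, (∑ z', D z' w * ∑ u, |A u z'| * K5 x y z t u) * (∑ z', D z' w * ∑ u, |A u z'| * Hk s u) / (1 - lamA) : ℝ))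
      * (ϑ x y * ϑ x z * ϑ x t * ϑ x s * ϑ y z * ϑ y t * ϑ y s * ϑ z t * ϑ z s * ϑ t s) ≤ dθ * αθ * (dθ' * αk5c) / (1 - lamA) := by
    have hw : ∀ x y z t : ι, ϑ x y * ϑ x z * ϑ x t * ϑ x s * ϑ y z * ϑ y t * ϑ y s * ϑ z t * ϑ z s * ϑ t s ≤ ϑ s x ^ 6 *
        (ϑ₂ x y * ϑ₂ x z * ϑ₂ x t * ϑ₂ y z * ϑ₂ y t * ϑ₂ z t) := fun x y z t =>
      ((prod10_le le_rfl le_rfl le_rfl ((hsy x s).le) le_rfl le_rfl (((hm10 y x s).trans (mul_le_mul_of_nonneg_left (hsy x s).le (h0 _ _))))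
              le_rfl (((hm10 z x s).trans (mul_le_mul_of_nonneg_left (hsy x s).le (h0 _ _))))
              (((hm10 t x s).trans (mul_le_mul_of_nonneg_left (hsy x s).le (h0 _ _)))) (h0 _ _) (h0 _ _) (h0 _ _) (h0 _ _) (h0 _ _) (h0 _ _)
              (h0 _ _) (h0 _ _) (h0 _ _) (h0 _ _)).trans_eq (by ring)).trans
          (mul_le_mul (pow_le_pow_right₀ (h1 s x) (by norm_num : 4 ≤ 6))
            (mul_le_mul
              (mul_le_mul
                (mul_le_mul
                  (mul_le_mul (mul_le_mul (hϑ2k x y 2 (by norm_num)) (hϑ2k x z 2 (by norm_num)) (pow_nonneg (h0 _ _) _) (hϑ₂0 _ _))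
                    (hϑ2k x t 2 (by norm_num)) (pow_nonneg (h0 _ _) _) (mul_nonneg (hϑ₂0 _ _) (hϑ₂0 _ _))) (hϑ2k y z 1 (by norm_num))
                  (pow_nonneg (h0 _ _) _) (mul_nonneg (mul_nonneg (hϑ₂0 _ _) (hϑ₂0 _ _)) (hϑ₂0 _ _))) (hϑ2k y t 1 (by norm_num))
                (pow_nonneg (h0 _ _) _) (mul_nonneg (mul_nonneg (mul_nonneg (hϑ₂0 _ _) (hϑ₂0 _ _)) (hϑ₂0 _ _)) (hϑ₂0 _ _)))
              (hϑ2k z t 1 (by norm_num)) (pow_nonneg (h0 _ _) _)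
              (mul_nonneg (mul_nonneg (mul_nonneg (mul_nonneg (hϑ₂0 _ _) (hϑ₂0 _ _)) (hϑ₂0 _ _)) (hϑ₂0 _ _)) (hϑ₂0 _ _)))
            (mul_nonneg
              (mul_nonneg
                (mul_nonneg (mul_nonneg (mul_nonneg (pow_nonneg (h0 x y) 2) (pow_nonneg (h0 x z) 2)) (pow_nonneg (h0 x t) 2))
                  (pow_nonneg (h0 y z) 1)) (pow_nonneg (h0 y t) 1)) (pow_nonneg (h0 z t) 1)) (pow_nonneg (h0 _ _) _))
    have h := weighted_two_point_family_le (R := ι × ι × ι × ι) (a := fun z' => ∑ u, |A u z'| * Hk s u)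
        (b := fun q z' => ∑ u, |A u z'| * K5 q.1 q.2.1 q.2.2.1 q.2.2.2 u) (σ := fun w => σ s w) (σ₁ := fun z' => σ s z')
        (σ' := fun q w => σ q.1 w * (ϑ₂ q.1 q.2.1 * ϑ₂ q.1 q.2.2.1 * ϑ₂ q.1 q.2.2.2 * ϑ₂ q.2.1 q.2.2.1 * ϑ₂ q.2.1 q.2.2.2 * ϑ₂ q.2.2.1 q.2.2.2))
        (σ'₁ := fun q z' => σ q.1 z' * (ϑ₂ q.1 q.2.1 * ϑ₂ q.1 q.2.2.1 * ϑ₂ q.1 q.2.2.2 * ϑ₂ q.2.1 q.2.2.1 * ϑ₂ q.2.1 q.2.2.2 * ϑ₂ q.2.2.1 q.2.2.2))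
        (ϑ := fun q => ϑ s q.1 ^ 6 * (ϑ₂ q.1 q.2.1 * ϑ₂ q.1 q.2.2.1 * ϑ₂ q.1 q.2.2.2 * ϑ₂ q.2.1 q.2.2.1 * ϑ₂ q.2.1 q.2.2.2 * ϑ₂ q.2.2.1 q.2.2.2))
        (fun z' => hF2 s z') (fun q z' => hF5 q.1 q.2.1 q.2.2.1 q.2.2.2 z') hD hθnn (fun w => hσ0 s w) (fun z' => hσ0 s z')
        (fun q w => hxI (hϑσ6 s q.1 w) (hI6 q.1 q.2.1 q.2.2.1 q.2.2.2)) (fun z' w => hσθ s z' w)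
        (fun q z' w => hσI (hσθ q.1 z' w) (hI6 q.1 q.2.1 q.2.2.1 q.2.2.2)) hDθr hdθ hDθc hdθ' (hbσ s)
        (fun z' => by simpa only [Fintype.sum_prod_type] using hk5c z') hαk5c hlamA1
    simp only [Fintype.sum_prod_type] at h
    refine le_trans ?_ h
    exact Finset.sum_le_sum fun x _ => Finset.sum_le_sum fun y _ => Finset.sum_le_sum fun z _ => Finset.sum_le_sum fun t _ =>
      mul_le_mul_of_nonneg_left (hw x y z t) (hE (hF5 x y z t) (hF2 s))
  simp (config := { maxSteps := 4000000 }) only [add_mul, Finset.sum_add_distrib]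
  linarith [tm0, tm1, tm2, tm3, tm4, tm5, tm6, tm7, tm8]

/-! ## Toy -/

/-- Toy (a routed load in numbers): carrying four pairs through one edge of weight `2` costs `2⁴ = 16 ≤ 2⁶`. -/
example : (2 : ℝ) ^ 4 ≤ 2 ^ 6 := by norm_num

end Summit.QuantumFields.BalabanUV.T4Continuum.NE7b.SupWeightedFifthOrderLettersFivePart1

end
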